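import Mathlib
import Literature.Probability.LatticeModels.SphereReflectionPositivityDimGeThree
import Summits.CriticalPhenomena.Ising3DConformalLimit.Theses.PositivityBegetsConformality
import HarnessLib

/-!
# The `1|1` level of inversion positivity: `TwoPointSpherePositivity`

(Item stmt-CriticalPhenomena-4676, the support statement "the 1|1 level is classical analysis
(card P1)" of route `PositivityBegetsConformality` for the sub-problem `Ising3DConformalLimit`;
proved by name as `twoPointSpherePositivity_proof`.)

For `Δ > 0` the kernel `K_Δ(x, y) = (1 − 2⟨x, y⟩ + ‖x‖²‖y‖²)^{−Δ}` — the pointwise form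
`‖y‖^{−2Δ} ‖x − ιy‖^{−2Δ}` of the Riesz kernel `‖x − y‖^{−2Δ}` reflected in the unit sphere,
`ι y = y/‖y‖²` — gives positive semidefinite matrices `(K_Δ(x_a, x_b))_{a,b}` for ALL finite
families `(x_a)` in the punctured open unit ball of `ℝ³` **if and only if** `Δ ≥ 1/2`.

Both halves are read off the Literature fact
`Literature.Probability.LatticeModels.neebOlafsson2014_ballKernel_posSemidef_iff`
(K.-H. Neeb, G. Ólafsson, J. Funct. Anal. 266 (2014), Prop. 6.2: the ball kernel
`(1 − 2⟨x,y⟩ + ‖x‖²‖y‖²)^{−s/2}` on the unit ball of `ℝⁿ` is positive definite iff `s = 0` or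
`s ≥ n − 2`), which is DISCHARGED in the tree
(`neebOlafsson2014_ballKernel_posSemidef_iff_holds`: Gegenbauer expansion, Gegenbauer→Legendre
connection coefficients `≥ 0`, zonal positivity; necessity by the witness `{0} ∪ {±ε eᵢ}`), at
`n = 3`, `s = 2Δ`:

* `(⇐)` is `ballKernel_posSemidef_dim3` (the puncture only removes admissible families);
* `(⇒)`: the Literature necessity statement quantifies over all families of the open ball, the
  route item only over families avoiding the origin. The bridge `ballKernel_posSemidef_of_punctured`
  replaces every point sitting at the origin by `t • e₀` and lets `t → 0⁺`: the kernel entries are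
  continuous there (the base `1 − 2⟨x,y⟩ + ‖x‖²‖y‖² ≥ (1 − ‖x‖‖y‖)² > 0` never vanishes on the
  ball) and positive semidefiniteness is closed under entrywise limits; then
  `neebOlafsson2014_ballKernel_posSemidef_only_if` gives `2Δ = 0 ∨ 1 ≤ 2Δ`, i.e. `Δ ≥ 1/2` as
  `Δ > 0`.

References: K.-H. Neeb, G. Ólafsson, *Reflection positivity and conformal symmetry*, J. Funct.
Anal. 266 (2014) 2174–2224 = arXiv:1206.2039, §6.2 Prop. 6.2 [NeebOlafsson2014]; R. L. Frank,
E. H. Lieb, Calc. Var. PDE 39 (2010) 85–99 [FrankLieb2010]; G. E. Andrews, R. Askey, R. Roy,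
*Special Functions* (CUP 1999), (6.4.10), Thm. 7.1.4' [AndrewsAskeyRoy1999].
-/

noncomputable section

open Literature.Probability.LatticeModels Filter Topology
open scoped RealInnerProductSpace

namespace Summit.CriticalPhenomena.Ising3DConformalLimit.Theorems

/-- **Punctured families suffice.** If the matrices `((1 − 2⟨x_a,x_b⟩ + ‖x_a‖²‖x_b‖²)^{−Δ})_{a,b}`
are positive semidefinite for all finite families in the *punctured* open unit ball of `ℝ³`, then
they are positive semidefinite for all finite families in the open unit ball: replace each point
at the origin by `t • e₀`, `0 < t < 1`, and let `t → 0⁺` (the entries are continuous in `t`, the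
base being `> 0` on the ball, and positive semidefiniteness passes to entrywise limits). -/
theorem ballKernel_posSemidef_of_punctured {Δ : ℝ}
    (H : ∀ (m : ℕ) (x : Fin m → EuclideanSpace ℝ (Fin 3)), (∀ a, x a ≠ 0 ∧ ‖x a‖ < 1) →
      (Matrix.of fun a b : Fin m =>
        (1 - 2 * inner ℝ (x a) (x b) + ‖x a‖ ^ 2 * ‖x b‖ ^ 2) ^ (-Δ)).PosSemidef)
    (m : ℕ) (x : Fin m → EuclideanSpace ℝ (Fin 3)) (hx : ∀ a, ‖x a‖ < 1) :
    (Matrix.of fun a b : Fin m =>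
      (1 - 2 * inner ℝ (x a) (x b) + ‖x a‖ ^ 2 * ‖x b‖ ^ 2) ^ (-Δ)).PosSemidef := by
  classical
  -- a unit vector to park the origin points on
  set e₀ : EuclideanSpace ℝ (Fin 3) := EuclideanSpace.single 0 1 with he₀
  have he₀norm : ‖e₀‖ = 1 := by simp [he₀]
  have he₀ne : e₀ ≠ 0 := norm_ne_zero_iff.1 (by rw [he₀norm]; exact one_ne_zero)
  -- the perturbed families `y t`
  set y : ℝ → Fin m → EuclideanSpace ℝ (Fin 3) := fun t a => if x a = 0 then t • e₀ else x a
    with hy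
  have hy_eq : ∀ t a, x a = 0 → y t a = t • e₀ := fun t a h => by simp [hy, h]
  have hy_ne : ∀ t a, x a ≠ 0 → y t a = x a := fun t a h => by simp [hy, h]
  have hy0 : y 0 = x := by
    funext a
    by_cases h : x a = 0
    · rw [hy_eq 0 a h, zero_smul, h]
    · exact hy_ne 0 a h
  have hycont : ∀ a, Continuous fun t => y t a := fun a => by
    by_cases h : x a = 0
    · have : (fun t => y t a) = fun t : ℝ => t • e₀ := funext fun t => hy_eq t a h
      rw [this]
      fun_prop
    · have : (fun t => y t a) = fun _ : ℝ => x a := funext fun t => hy_ne t a h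
      rw [this]
      exact continuous_const
  have hyadm : ∀ t ∈ Set.Ioo (0 : ℝ) 1, ∀ a, y t a ≠ 0 ∧ ‖y t a‖ < 1 := by
    intro t ht a
    by_cases h : x a = 0
    · rw [hy_eq t a h]
      refine ⟨smul_ne_zero ht.1.ne' he₀ne, ?_⟩
      rw [norm_smul, he₀norm, mul_one, Real.norm_eq_abs, abs_of_pos ht.1]
      exact ht.2
    · rw [hy_ne t a h]
      exact ⟨h, hx a⟩
  -- the kernel entries along the perturbation
  set K : ℝ → Fin m → Fin m → ℝ := fun t a b =>
    (1 - 2 * inner ℝ (y t a) (y t b) + ‖y t a‖ ^ 2 * ‖y t b‖ ^ 2) ^ (-Δ) with hK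
  have hKt : ∀ a b, Tendsto (fun t => K t a b) (𝓝[>] 0) (𝓝 (K 0 a b)) := by
    intro a b
    apply tendsto_nhdsWithin_of_tendsto_nhds
    have h1 : Continuous fun t => inner ℝ (y t a) (y t b) := (hycont a).inner (hycont b)
    have h2 : Continuous fun t => ‖y t a‖ := (hycont a).norm
    have h3 : Continuous fun t => ‖y t b‖ := (hycont b).norm
    have hbase : Continuous fun t =>
        1 - 2 * inner ℝ (y t a) (y t b) + ‖y t a‖ ^ 2 * ‖y t b‖ ^ 2 :=
      (continuous_const.sub (continuous_const.mul h1)).add ((h2.pow 2).mul (h3.pow 2))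
    have hpos : 1 - 2 * inner ℝ (y 0 a) (y 0 b) + ‖y 0 a‖ ^ 2 * ‖y 0 b‖ ^ 2 ≠ 0 := by
      rw [hy0]
      exact (ballKernel_base_pos
        (mul_lt_one_of_nonneg_of_lt_one_left (norm_nonneg _) (hx a) (hx b).le)).ne'
    exact (hbase.tendsto 0).rpow_const (Or.inl hpos)
  have hsymm : ∀ t a b, K t a b = K t b a := fun t a b => by
    simp only [hK]
    rw [real_inner_comm (y t a) (y t b), mul_comm (‖y t b‖ ^ 2)]
  -- positive semidefiniteness passes to the limit `t → 0⁺`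
  have hgoal : (Matrix.of fun a b : Fin m => K 0 a b).PosSemidef := by
    refine (posSemidef_iff_sum_mul_nonneg fun a b => hsymm 0 a b).2 fun c => ?_
    have ht : Tendsto (fun t => ∑ a, ∑ b, c a * c b * K t a b) (𝓝[>] 0)
        (𝓝 (∑ a, ∑ b, c a * c b * K 0 a b)) :=
      tendsto_finsetSum _ fun a _ => tendsto_finsetSum _ fun b _ => (hKt a b).const_mul _
    refine ge_of_tendsto ht ?_
    filter_upwards [Ioo_mem_nhdsGT (zero_lt_one' ℝ)] with t ht
    have h := sum_mul_nonneg_of_posSemidef (H m (y t) (hyadm t ht)) c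
    simpa only [Matrix.of_apply] using h
  simpa only [hK, hy0] using hgoal

/-- **`TwoPointSpherePositivity` (item stmt-CriticalPhenomena-4676), proved by name.** For `Δ > 0`,
the matrices `((1 − 2⟨x_a, x_b⟩ + ‖x_a‖²‖x_b‖²)^{−Δ})_{a,b}` are positive semidefinite for every
finite family in the punctured open unit ball of `ℝ³` iff `1/2 ≤ Δ`: Neeb–Ólafsson 2014,
Prop. 6.2 at `n = 3`, `s = 2Δ` (`neebOlafsson2014_ballKernel_posSemidef_iff_holds`), the `(⇒)`
half through `ballKernel_posSemidef_of_punctured`. -/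
theorem twoPointSpherePositivity_proof :
    Summit.CriticalPhenomena.Ising3DConformalLimit.Theses.PositivityBegetsConformality.TwoPointSpherePositivity := by
  intro Δ hΔ
  constructor
  · intro H
    have H' : ∀ (m : ℕ) (x : Fin m → EuclideanSpace ℝ (Fin 3)), (∀ a, ‖x a‖ < 1) →
        (Matrix.of fun a b : Fin m =>
          (1 - 2 * inner ℝ (x a) (x b) + ‖x a‖ ^ 2 * ‖x b‖ ^ 2) ^ (-(2 * Δ) / 2)).PosSemidef := by
      intro m x hx
      rw [show -(2 * Δ) / 2 = -Δ by ring]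
      exact ballKernel_posSemidef_of_punctured H m x hx
    rcases neebOlafsson2014_ballKernel_posSemidef_only_if 3 (2 * Δ) (by linarith) H' with h0 | h1
    · linarith
    · have h1' : (1 : ℝ) ≤ 2 * Δ := by push_cast at h1; linarith
      linarith
  · intro hΔ' m x hx
    exact ballKernel_posSemidef_dim3 neebOlafsson2014_ballKernel_posSemidef_iff_holds hΔ' m x
      fun a => (hx a).2

end Summit.CriticalPhenomena.Ising3DConformalLimit.Theorems

end
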